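import Mathlib
import Literature.NumberTheory.LFunctions.WeilArchimedeanMoments

/-!
# Certified quadrature toolkit for the route's fixed bump `φ₀(u) = expNegInvGlue (1 - u²)`
(crux `WeilComb.CombShapePositivity`, item stmt-RiemannHypothesis-11229, line `Sketch`; towards the bump constants
`I₀ = ∫ φ₀`, `N₀ = ‖φ₀‖₂²`, `R = I₀²/N₀` that every explicit form of Theorem B / `stub_windowCore` consumes)

`φ₀(u) = exp(−1/(1 − u²))` on `(−1, 1)`, `0` outside.  Writing `φ(u) = 1/(1 − u²)`, the function `φ` is CONVEX on
`[0, 1)`; on a cell `[a, b] ⊂ [0, 1)` this gives the two elementary brackets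
* chord:  `φ(u) ≤ φ(a) + (u − a)·(φ(b) − φ(a))/(b − a)`  (`inv_one_sub_sq_le_chord`),
* secant from the previous node `a' < a`:  `φ(u) ≥ φ(a) + (u − a)·(φ(a) − φ(a'))/(a − a')`
  (`secant_le_inv_one_sub_sq`),
both proved by explicit factorisations.  Exponentiating and integrating the resulting exponentials in closed form:
* `cell_lower`:  `(e^{−cφ(a)} − e^{−cφ(b)})·(b − a)/(cφ(b) − cφ(a)) ≤ ∫_a^b φ₀^m`  (`c = m`),
* `cell_upper`:  on a uniform grid (`a − a' = b − a`)
  `∫_a^b φ₀^m ≤ e^{−cφ(a)}·(1 − e^{−cφ(a)}/e^{−cφ(a')})·(a − a')/(cφ(a) − cφ(a'))`,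
* `cell_crude`: `∫_a^b φ₀^m ≤ (b − a)·e^{−cφ(a)}` for `0 ≤ a < b ≤ 1` (used on the last cell), `cell_nonneg`.
Both main rules are exact for exponentials, so their error is second order in the mesh.  Finally
`integral_shapeBump_pow_eq` : `∫_ℝ φ₀^m = 2 ∫_0^1 φ₀^m` (support and evenness), the specialisations to
`∫ φ₀` and `weilNorm2Sq φ₀`.  The node enclosures (Taylor polynomial with `Real.exp_bound`, repeated squaring), the
numeric forms of the cell rules and the 32-cell certificates are in `…BumpNodes32.lean`, `…BumpIntegral.lean`,
`…BumpNorm.lean`.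
-/

noncomputable section

-- the sub-problem path `RiemannHypothesis/RiemannHypothesis` (single-conjunct summit, D-0017) duplicates a namespace
set_option linter.dupNamespace false

open Real MeasureTheory Set intervalIntegral

namespace Summit.RiemannHypothesis.RiemannHypothesis.Theorems.WeilCombBohrFejer

/-! ## The bump as an exponential on `(−1, 1)` -/

/-- Inside `(−1,1)`: `φ₀(u) = exp(−1/(1 − u²))`. [folklore] -/
theorem shapeBump_eq_exp {u : ℝ} (hu : u ^ 2 < 1) :
    expNegInvGlue (1 - u ^ 2) = Real.exp (-(1 / (1 - u ^ 2))) := by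
  have h : 0 < 1 - u ^ 2 := by linarith
  simp [expNegInvGlue, not_le.mpr h, one_div]

/-- Inside `(−1,1)`: `φ₀(u)^m = exp(−m/(1 − u²))`. [folklore] -/
theorem shapeBump_pow_eq_exp {u : ℝ} (hu : u ^ 2 < 1) (m : ℕ) :
    expNegInvGlue (1 - u ^ 2) ^ m = Real.exp (-((m : ℝ) / (1 - u ^ 2))) := by
  rw [shapeBump_eq_exp hu, ← Real.exp_nat_mul]
  congr 1
  ring

/-- Outside `(−1,1)`: `φ₀(u) = 0`. [folklore] -/
theorem shapeBump_eq_zero {u : ℝ} (hu : 1 ≤ u ^ 2) : expNegInvGlue (1 - u ^ 2) = 0 :=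
  expNegInvGlue.zero_of_nonpos (by linarith)

/-- `φ₀ ≥ 0`. [folklore] -/
theorem shapeBump_nonneg (u : ℝ) : 0 ≤ expNegInvGlue (1 - u ^ 2) := expNegInvGlue.nonneg _

/-- `φ₀^m` is continuous. [folklore] -/
theorem continuous_shapeBump_pow (m : ℕ) : Continuous fun u : ℝ => expNegInvGlue (1 - u ^ 2) ^ m :=
  ((expNegInvGlue.contDiff (n := 0)).continuous.comp (continuous_const.sub (continuous_id.pow 2))).pow m

/-- `φ₀^m` is interval-integrable on every interval. [folklore] -/
theorem intervalIntegrable_shapeBump_pow (m : ℕ) (a b : ℝ) :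
    IntervalIntegrable (fun u : ℝ => expNegInvGlue (1 - u ^ 2) ^ m) volume a b :=
  (continuous_shapeBump_pow m).intervalIntegrable a b

/-! ## Convexity brackets for `φ(u) = 1/(1 − u²)` on `[0, 1)` -/

/-- **Chord.** For `0 ≤ a ≤ u ≤ b < 1`, `a < b`:
`1/(1−u²) ≤ 1/(1−a²) + (u − a)·(1/(1−b²) − 1/(1−a²))/(b − a)`; indeed the difference is
`(u−a)(b−u)(1 + ub + ab + au)/((1−a²)(1−b²)(1−u²)) ≥ 0`. [folklore] -/
theorem inv_one_sub_sq_le_chord {a b u : ℝ} (ha : 0 ≤ a) (hau : a ≤ u) (hub : u ≤ b) (hb : b < 1) (hab : a < b) :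
    1 / (1 - u ^ 2) ≤ 1 / (1 - a ^ 2) + (u - a) * ((1 / (1 - b ^ 2) - 1 / (1 - a ^ 2)) / (b - a)) := by
  have ha1 : 0 < 1 - a ^ 2 := by nlinarith
  have hb1 : 0 < 1 - b ^ 2 := by nlinarith
  have hu1 : 0 < 1 - u ^ 2 := by nlinarith
  have hba : 0 < b - a := by linarith
  have key : 1 / (1 - a ^ 2) + (u - a) * ((1 / (1 - b ^ 2) - 1 / (1 - a ^ 2)) / (b - a)) - 1 / (1 - u ^ 2) =
      (u - a) * (b - u) * (1 + u * b + a * b + a * u) / ((1 - a ^ 2) * (1 - b ^ 2) * (1 - u ^ 2)) := by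
    field_simp
    ring
  have hnum : 0 ≤ (u - a) * (b - u) * (1 + u * b + a * b + a * u) := by
    apply mul_nonneg (mul_nonneg (by linarith) (by linarith))
    nlinarith
  have hfrac : 0 ≤ (u - a) * (b - u) * (1 + u * b + a * b + a * u) /
      ((1 - a ^ 2) * (1 - b ^ 2) * (1 - u ^ 2)) := div_nonneg hnum (by positivity)
  linarith

/-- **Secant from the left.** For `0 ≤ a' < a ≤ u < 1`:
`1/(1−a²) + (u − a)·(1/(1−a²) − 1/(1−a'²))/(a − a') ≤ 1/(1−u²)`; the difference is
`(u−a)(u−a')(1 + ua' + aa' + au)/((1−a²)(1−a'²)(1−u²)) ≥ 0`. [folklore] -/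
theorem secant_le_inv_one_sub_sq {a' a u : ℝ} (ha' : 0 ≤ a') (haa : a' < a) (hau : a ≤ u) (hu : u < 1) :
    1 / (1 - a ^ 2) + (u - a) * ((1 / (1 - a ^ 2) - 1 / (1 - a' ^ 2)) / (a - a')) ≤ 1 / (1 - u ^ 2) := by
  have ha1 : 0 < 1 - a ^ 2 := by nlinarith
  have hb1 : 0 < 1 - a' ^ 2 := by nlinarith
  have hu1 : 0 < 1 - u ^ 2 := by nlinarith
  have hba : 0 < a - a' := by linarith
  have key : 1 / (1 - u ^ 2) - (1 / (1 - a ^ 2) + (u - a) * ((1 / (1 - a ^ 2) - 1 / (1 - a' ^ 2)) / (a - a'))) =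
      (u - a) * (u - a') * (1 + u * a' + a * a' + a * u) / ((1 - a ^ 2) * (1 - a' ^ 2) * (1 - u ^ 2)) := by
    field_simp
    ring
  have hnum : 0 ≤ (u - a) * (u - a') * (1 + u * a' + a * a' + a * u) := by
    apply mul_nonneg (mul_nonneg (by linarith) (by linarith))
    nlinarith
  have hfrac : 0 ≤ (u - a) * (u - a') * (1 + u * a' + a * a' + a * u) /
      ((1 - a ^ 2) * (1 - a' ^ 2) * (1 - u ^ 2)) := div_nonneg hnum (by positivity)
  linarith

/-- `φ` is increasing on `[0,1)`: `1/(1−a²) ≤ 1/(1−u²)` for `0 ≤ a ≤ u < 1`. [folklore] -/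
theorem inv_one_sub_sq_mono {a u : ℝ} (ha : 0 ≤ a) (hau : a ≤ u) (hu : u < 1) :
    1 / (1 - a ^ 2) ≤ 1 / (1 - u ^ 2) := by
  have hu1 : 0 < 1 - u ^ 2 := by nlinarith
  apply one_div_le_one_div_of_le hu1
  nlinarith

/-! ## Closed-form integral of an exponential -/

/-- `∫_a^b K e^{−σ(u − a)} du = K (1 − e^{−σ(b−a)})/σ` (`σ ≠ 0`). [folklore] -/
theorem integral_const_mul_exp_neg_mul_sub (K σ a b : ℝ) (hσ : σ ≠ 0) :
    ∫ u in a..b, K * Real.exp (-(σ * (u - a))) = K * (1 - Real.exp (-(σ * (b - a)))) / σ := by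
  have hderiv : ∀ u ∈ uIcc a b,
      HasDerivAt (fun u : ℝ => -(K / σ) * Real.exp (-(σ * (u - a)))) (K * Real.exp (-(σ * (u - a)))) u := by
    intro u _
    have h1 : HasDerivAt (fun u : ℝ => -(σ * (u - a))) (-σ) u := by
      have h := ((hasDerivAt_id u).const_mul (-σ)).add_const (σ * a)
      simp only [mul_one] at h
      have e : (fun u : ℝ => -(σ * (u - a))) = fun x => -σ * id x + σ * a := by
        funext v
        simp only [id]
        ring
      rw [e]
      exact h
    have h2 := (Real.hasDerivAt_exp _).comp u h1
    have h3 := h2.const_mul (-(K / σ))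
    have e3 : -(K / σ) * (Real.exp (-(σ * (u - a))) * -σ) = K * Real.exp (-(σ * (u - a))) := by
      field_simp
    rw [e3] at h3
    exact h3
  have hint : IntervalIntegrable (fun u : ℝ => K * Real.exp (-(σ * (u - a)))) volume a b :=
    (continuous_const.mul (Real.continuous_exp.comp
      (continuous_const.mul (continuous_id.sub continuous_const)).neg)).intervalIntegrable a b
  rw [integral_eq_sub_of_hasDerivAt hderiv hint]
  simp only [sub_self, mul_zero, neg_zero, Real.exp_zero, mul_one]
  field_simp
  ring

/-! ## Cell bounds -/

/-- **Lower cell bound (chord rule).** For `0 ≤ a < b < 1` and `m ≥ 1`, with `c = m`: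
`(e^{−c/(1−a²)} − e^{−c/(1−b²)})·(b − a)/(c/(1−b²) − c/(1−a²)) ≤ ∫_a^b φ₀^m`. [folklore] -/
theorem cell_lower {a b : ℝ} (ha : 0 ≤ a) (hab : a < b) (hb : b < 1) {m : ℕ} (hm : 1 ≤ m) :
    (Real.exp (-((m : ℝ) / (1 - a ^ 2))) - Real.exp (-((m : ℝ) / (1 - b ^ 2)))) *
        ((b - a) / ((m : ℝ) / (1 - b ^ 2) - (m : ℝ) / (1 - a ^ 2))) ≤
      ∫ u in a..b, expNegInvGlue (1 - u ^ 2) ^ m := by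
  have hm0 : (0 : ℝ) < m := by exact_mod_cast hm
  have ha1 : 0 < 1 - a ^ 2 := by nlinarith
  have hb1 : 0 < 1 - b ^ 2 := by nlinarith
  -- the slope `σ = (cφ(b) − cφ(a))/(b − a) > 0`
  set σ : ℝ := ((m : ℝ) / (1 - b ^ 2) - (m : ℝ) / (1 - a ^ 2)) / (b - a) with hσ
  have hφab : (m : ℝ) / (1 - a ^ 2) < (m : ℝ) / (1 - b ^ 2) := by
    apply div_lt_div_of_pos_left hm0 hb1
    nlinarith
  have hσpos : 0 < σ := div_pos (by linarith) (by linarith)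
  set K : ℝ := Real.exp (-((m : ℝ) / (1 - a ^ 2))) with hK
  -- pointwise: `K e^{−σ(u−a)} ≤ φ₀(u)^m` on `[a, b]`
  have hpt : ∀ u ∈ Icc a b, K * Real.exp (-(σ * (u - a))) ≤ expNegInvGlue (1 - u ^ 2) ^ m := by
    intro u hu
    have hu1 : u ^ 2 < 1 := by nlinarith [hu.1, hu.2]
    rw [shapeBump_pow_eq_exp hu1 m, hK, ← Real.exp_add]
    apply Real.exp_le_exp.2
    have hch := inv_one_sub_sq_le_chord ha hu.1 hu.2 hb hab
    have := mul_le_mul_of_nonneg_left hch hm0.le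
    have e1 : (m : ℝ) * (1 / (1 - u ^ 2)) = (m : ℝ) / (1 - u ^ 2) := by ring
    have e2 : (m : ℝ) * (1 / (1 - a ^ 2) + (u - a) * ((1 / (1 - b ^ 2) - 1 / (1 - a ^ 2)) / (b - a))) =
        (m : ℝ) / (1 - a ^ 2) + σ * (u - a) := by
      rw [hσ]
      field_simp
    rw [e1, e2] at this
    linarith
  -- integrate
  have hint1 : IntervalIntegrable (fun u : ℝ => K * Real.exp (-(σ * (u - a)))) volume a b :=
    (continuous_const.mul (Real.continuous_exp.comp
      (continuous_const.mul (continuous_id.sub continuous_const)).neg)).intervalIntegrable a b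
  have hmono := intervalIntegral.integral_mono_on hab.le hint1 (intervalIntegrable_shapeBump_pow m a b) hpt
  rw [integral_const_mul_exp_neg_mul_sub K σ a b hσpos.ne'] at hmono
  -- identify the closed form: `σ(b−a) = cφ(b) − cφ(a)`, `K e^{−σ(b−a)} = e^{−cφ(b)}`
  have eσ : σ * (b - a) = (m : ℝ) / (1 - b ^ 2) - (m : ℝ) / (1 - a ^ 2) := by
    rw [hσ]
    have hne' : b - a ≠ 0 := by linarith
    field_simp
  have eK : K * (1 - Real.exp (-(σ * (b - a)))) / σ =
      (Real.exp (-((m : ℝ) / (1 - a ^ 2))) - Real.exp (-((m : ℝ) / (1 - b ^ 2)))) *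
        ((b - a) / ((m : ℝ) / (1 - b ^ 2) - (m : ℝ) / (1 - a ^ 2))) := by
    rw [mul_sub, mul_one, hK, ← Real.exp_add, eσ]
    have : -((m : ℝ) / (1 - a ^ 2)) + -((m : ℝ) / (1 - b ^ 2) - (m : ℝ) / (1 - a ^ 2)) =
        -((m : ℝ) / (1 - b ^ 2)) := by ring
    rw [this, hσ]
    have hne : (m : ℝ) / (1 - b ^ 2) - (m : ℝ) / (1 - a ^ 2) ≠ 0 := by linarith
    have hne' : b - a ≠ 0 := by linarith
    field_simp
  rw [eK] at hmono
  exact hmono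

/-- **Upper cell bound (secant rule) on a uniform grid.** For `0 ≤ a' < a < b < 1` with `a − a' = b − a` and
`m ≥ 1`, `c = m`:
`∫_a^b φ₀^m ≤ e^{−c/(1−a²)}·(1 − e^{−c/(1−a²)}/e^{−c/(1−a'²)})·(a − a')/(c/(1−a²) − c/(1−a'²))`. [folklore] -/
theorem cell_upper {a' a b : ℝ} (ha' : 0 ≤ a') (haa : a' < a) (hab : a < b) (hb : b < 1) (hunif : a - a' = b - a)
    {m : ℕ} (hm : 1 ≤ m) :
    ∫ u in a..b, expNegInvGlue (1 - u ^ 2) ^ m ≤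
      Real.exp (-((m : ℝ) / (1 - a ^ 2))) *
        (1 - Real.exp (-((m : ℝ) / (1 - a ^ 2))) / Real.exp (-((m : ℝ) / (1 - a' ^ 2)))) *
        ((a - a') / ((m : ℝ) / (1 - a ^ 2) - (m : ℝ) / (1 - a' ^ 2))) := by
  have hm0 : (0 : ℝ) < m := by exact_mod_cast hm
  have ha1 : 0 < 1 - a ^ 2 := by nlinarith
  have hb1 : 0 < 1 - a' ^ 2 := by nlinarith
  set σ : ℝ := ((m : ℝ) / (1 - a ^ 2) - (m : ℝ) / (1 - a' ^ 2)) / (a - a') with hσ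
  have hφab : (m : ℝ) / (1 - a' ^ 2) < (m : ℝ) / (1 - a ^ 2) := by
    apply div_lt_div_of_pos_left hm0 ha1
    nlinarith
  have hσpos : 0 < σ := div_pos (by linarith) (by linarith)
  set K : ℝ := Real.exp (-((m : ℝ) / (1 - a ^ 2))) with hK
  -- pointwise: `φ₀(u)^m ≤ K e^{−σ(u−a)}` on `[a, b]`
  have hpt : ∀ u ∈ Icc a b, expNegInvGlue (1 - u ^ 2) ^ m ≤ K * Real.exp (-(σ * (u - a))) := by
    intro u hu
    have hu1' : u < 1 := lt_of_le_of_lt hu.2 hb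
    have hu1 : u ^ 2 < 1 := by nlinarith [hu.1, hu.2]
    rw [shapeBump_pow_eq_exp hu1 m, hK, ← Real.exp_add]
    apply Real.exp_le_exp.2
    have hsec := secant_le_inv_one_sub_sq ha' haa hu.1 hu1'
    have := mul_le_mul_of_nonneg_left hsec hm0.le
    have e1 : (m : ℝ) * (1 / (1 - u ^ 2)) = (m : ℝ) / (1 - u ^ 2) := by ring
    have e2 : (m : ℝ) * (1 / (1 - a ^ 2) + (u - a) * ((1 / (1 - a ^ 2) - 1 / (1 - a' ^ 2)) / (a - a'))) =
        (m : ℝ) / (1 - a ^ 2) + σ * (u - a) := by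
      rw [hσ]
      field_simp
    rw [e1, e2] at this
    linarith
  have hint1 : IntervalIntegrable (fun u : ℝ => K * Real.exp (-(σ * (u - a)))) volume a b :=
    (continuous_const.mul (Real.continuous_exp.comp
      (continuous_const.mul (continuous_id.sub continuous_const)).neg)).intervalIntegrable a b
  have hmono := intervalIntegral.integral_mono_on hab.le (intervalIntegrable_shapeBump_pow m a b) hint1 hpt
  rw [integral_const_mul_exp_neg_mul_sub K σ a b hσpos.ne'] at hmono
  have eσ : σ * (b - a) = (m : ℝ) / (1 - a ^ 2) - (m : ℝ) / (1 - a' ^ 2) := by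
    rw [hσ, ← hunif]
    have hne' : a - a' ≠ 0 := by linarith
    field_simp
  have eK : K * (1 - Real.exp (-(σ * (b - a)))) / σ =
      Real.exp (-((m : ℝ) / (1 - a ^ 2))) *
        (1 - Real.exp (-((m : ℝ) / (1 - a ^ 2))) / Real.exp (-((m : ℝ) / (1 - a' ^ 2)))) *
        ((a - a') / ((m : ℝ) / (1 - a ^ 2) - (m : ℝ) / (1 - a' ^ 2))) := by
    rw [eσ, ← Real.exp_sub, hK, hσ]
    have : -((m : ℝ) / (1 - a ^ 2)) - -((m : ℝ) / (1 - a' ^ 2)) =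
        -((m : ℝ) / (1 - a ^ 2) - (m : ℝ) / (1 - a' ^ 2)) := by ring
    rw [this]
    have hne : (m : ℝ) / (1 - a ^ 2) - (m : ℝ) / (1 - a' ^ 2) ≠ 0 := by linarith
    have hne' : a - a' ≠ 0 := by linarith
    field_simp
  rw [eK] at hmono
  exact hmono

/-- **Crude cell bound.** For `0 ≤ a < b`, `m ≥ 1`: `∫_a^b φ₀^m ≤ (b − a)·e^{−m/(1−a²)}` (`φ₀^m` is
non-increasing on `[a, 1)` and vanishes from `1` on). [folklore] -/
theorem cell_crude {a b : ℝ} (ha : 0 ≤ a) (hab : a < b) {m : ℕ} (hm : 1 ≤ m) :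
    ∫ u in a..b, expNegInvGlue (1 - u ^ 2) ^ m ≤ (b - a) * Real.exp (-((m : ℝ) / (1 - a ^ 2))) := by
  have hm0 : (0 : ℝ) < m := by exact_mod_cast hm
  have hpt : ∀ u ∈ Icc a b, expNegInvGlue (1 - u ^ 2) ^ m ≤ Real.exp (-((m : ℝ) / (1 - a ^ 2))) := by
    intro u hu
    rcases lt_or_ge u 1 with hu1 | hu1
    · have hu2 : u ^ 2 < 1 := by nlinarith [hu.1]
      rw [shapeBump_pow_eq_exp hu2 m]
      apply Real.exp_le_exp.2
      have hmono := inv_one_sub_sq_mono ha hu.1 hu1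
      have := mul_le_mul_of_nonneg_left hmono hm0.le
      have e1 : (m : ℝ) * (1 / (1 - u ^ 2)) = (m : ℝ) / (1 - u ^ 2) := by ring
      have e2 : (m : ℝ) * (1 / (1 - a ^ 2)) = (m : ℝ) / (1 - a ^ 2) := by ring
      linarith
    · have hu2 : 1 ≤ u ^ 2 := by nlinarith
      rw [shapeBump_eq_zero hu2, zero_pow (by omega)]
      exact (Real.exp_pos _).le
  have hmono := intervalIntegral.integral_mono_on hab.le (intervalIntegrable_shapeBump_pow m a b)
    (intervalIntegrable_const) hpt
  simpa [intervalIntegral.integral_const, smul_eq_mul] using hmono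

/-- `0 ≤ ∫_a^b φ₀^m` for `a ≤ b`. [folklore] -/
theorem cell_nonneg {a b : ℝ} (hab : a ≤ b) (m : ℕ) : 0 ≤ ∫ u in a..b, expNegInvGlue (1 - u ^ 2) ^ m :=
  intervalIntegral.integral_nonneg hab fun u _ => pow_nonneg (shapeBump_nonneg u) m

/-! ## Reduction of `∫ φ₀^m` over `ℝ` to `[0, 1]` -/

/-- `∫_ℝ φ₀^m = 2 ∫_0^1 φ₀^m` for `m ≥ 1` (support `[−1, 1]`, evenness). [folklore] -/
theorem integral_shapeBump_pow_eq {m : ℕ} (hm : 1 ≤ m) :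
    ∫ u : ℝ, expNegInvGlue (1 - u ^ 2) ^ m = 2 * ∫ u in (0 : ℝ)..1, expNegInvGlue (1 - u ^ 2) ^ m := by
  set g : ℝ → ℝ := fun u => expNegInvGlue (1 - u ^ 2) ^ m with hg
  have hzero : ∀ u ∉ Icc (-1 : ℝ) 1, g u = 0 := by
    intro u hu
    simp only [mem_Icc, not_and_or, not_le] at hu
    have hu2 : 1 ≤ u ^ 2 := by rcases hu with h | h <;> nlinarith
    simp [hg, shapeBump_eq_zero hu2, zero_pow (by omega : m ≠ 0)]
  have h1 : ∫ u : ℝ, g u = ∫ u in Icc (-1 : ℝ) 1, g u :=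
    (setIntegral_eq_integral_of_forall_compl_eq_zero hzero).symm
  have h2 : ∫ u in Icc (-1 : ℝ) 1, g u = ∫ u in (-1 : ℝ)..1, g u := by
    rw [integral_Icc_eq_integral_Ioc, ← intervalIntegral.integral_of_le (by norm_num)]
  have h3 : ∫ u in (-1 : ℝ)..1, g u = (∫ u in (-1 : ℝ)..0, g u) + ∫ u in (0 : ℝ)..1, g u :=
    (intervalIntegral.integral_add_adjacent_intervals (intervalIntegrable_shapeBump_pow m _ _)
      (intervalIntegrable_shapeBump_pow m _ _)).symm
  have h4 : ∫ u in (-1 : ℝ)..0, g u = ∫ u in (0 : ℝ)..1, g u := by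
    have heven : (fun u => g (-u)) = g := by
      funext u
      simp [hg]
    calc ∫ u in (-1 : ℝ)..0, g u = ∫ u in (-1 : ℝ)..0, g (-u) := by rw [heven]
      _ = ∫ u in (-0 : ℝ)..(-(-1)), g u := intervalIntegral.integral_comp_neg _
      _ = ∫ u in (0 : ℝ)..1, g u := by norm_num
  change ∫ u : ℝ, g u = 2 * ∫ u in (0 : ℝ)..1, g u
  rw [h1, h2, h3, h4]
  ring

/-- `I₀ = ∫ φ₀ = 2 ∫_0^1 φ₀`. [folklore] -/
theorem integral_shapeBump_eq_two_mul :
    ∫ u : ℝ, expNegInvGlue (1 - u ^ 2) = 2 * ∫ u in (0 : ℝ)..1, expNegInvGlue (1 - u ^ 2) ^ 1 := by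
  rw [← integral_shapeBump_pow_eq le_rfl]
  simp

/-- `N₀ = ‖φ₀‖₂² = 2 ∫_0^1 φ₀²`. [folklore] -/
theorem weilNorm2Sq_shapeBump_eq_two_mul :
    Literature.NumberTheory.LFunctions.weilNorm2Sq (fun u : ℝ => ((expNegInvGlue (1 - u ^ 2) : ℝ) : ℂ)) =
      2 * ∫ u in (0 : ℝ)..1, expNegInvGlue (1 - u ^ 2) ^ 2 := by
  rw [← integral_shapeBump_pow_eq (by norm_num)]
  unfold Literature.NumberTheory.LFunctions.weilNorm2Sq
  congr 1 with u
  rw [Complex.norm_real, Real.norm_eq_abs, sq_abs]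

end Summit.RiemannHypothesis.RiemannHypothesis.Theorems.WeilCombBohrFejer

end
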